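import Literature.MathematicalPhysics.QuantumLattice.GrassmannFlowStep
import Literature.MathematicalPhysics.QuantumLattice.GrassmannEffectiveActionScales
import HarnessLib

/-!
# Iterating the single-scale step: the flow of majorants along a finite sequence of slices

Topic `MathematicalPhysics/QuantumLattice`; the multi-slice packaging of `GrassmannFlowStep.lean` (one step of the flow of
the kernels: `Σ_{W : W_i = w} ‖kernel (effAction C V) m W‖ ≤ N(m) + Σ_{1 ≤ j < k} ((m+2j)!/(m! j! 2^j)) s^j N(m+2j) +
ρ^{-m} e‖V‖_h θ/(1-θ)`) with `GrassmannEffectiveActionScales.lean` (`iterEffAction`: integrating the slices `C 0, C 1, …`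
one after the other; `effAction (Σ_{j<n} C j) V = 𝒱^{(n)}` and the factorisation of the partition function when every
single-slice partition function is a unit).  Benfatto–Giuliani–Mastropietro 2006, (2.12)–(2.14) with (2.77)–(2.80) and
(2.86)–(2.90), in the regime where NOTHING IS RENORMALISED: the kernels of the iterated effective actions are bounded by
any sequence of MAJORANTS `N j : ℕ → ℝ` that dominates, slice after slice, the one-step flow inequality evaluated at the
previous majorant — a finite recursion of real numbers, to be discharged by the power counting of the model at hand
(e.g. finitely many Matsubara slices with polynomial room, or the running-coupling induction of `RunningCouplingFlow.lean`).

* `effAction_mem_evenPart` — the effective action of an even interaction is even (parity bookkeeping for the iteration);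
* **`iterEffAction_flow`** — for slices `C 0, …, C (K-1)` on one label set, each charged in Gram form (`κ j`), with
  row/column sums `≤ α j`, sup `≤ s j`, `Δ_{C j}^{k j} = 0`, output weights `ρ j`, and majorants with `N 0 ≥` the pinned
  norms of `V`, `θ j := e α_j ‖N j‖_{h_j}/κ_j² < 1` and `N (j+1) m ≥` [one-step flow bound at `N j`] for `m ≥ 1`: for every
  `n ≤ K` all single-slice partition functions below `n` are units, `𝒱^{(n)} = iterEffAction C n V` is even without
  constant part, and its pinned kernel norms are `≤ N n m` in every degree;
* **`effAction_sum_flow`** — consequently `effAction (Σ_{j<K} C j) V = 𝒱^{(K)}`, the total partition function is the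
  product of the single-slice ones and a unit, and the kernels of the total effective action are bounded by `N K`.

Everything is proved; no definition, no named fact.

## Sources

G. Benfatto, A. Giuliani, V. Mastropietro, Ann. Henri Poincaré 7 (2006) 809–898, (2.12)–(2.14), (2.77)–(2.80),
(2.86)–(2.90) [`BenfattoGiulianiMastropietro2006`]; K. Gawȩdzki, A. Kupiainen, Comm. Math. Phys. 102 (1985) 1–30, §3
[`GawedzkiKupiainen1985GrossNeveu`]; M. Salmhofer, *Renormalization* (1999), §2.5.1 (2.105)–(2.106), §4.3
[`Salmhofer1999`].
-/

noncomputable section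

namespace Literature.MathematicalPhysics.QuantumLattice

open GrassmannAlgebra Finset Literature.Probability.LatticeModels
open scoped InnerProductSpace Nat

variable {𝕜 : Type*} [RCLike 𝕜] {Γ : Type*} [Fintype Γ] [DecidableEq Γ]

/-! ### Parity of the effective action -/

omit [Fintype Γ] [DecidableEq Γ] in
/-- The truncated logarithm of an even element is even. [folklore] -/
private theorem grassmannLog1p_mem_evenPart {x : GrassmannAlgebra 𝕜 Γ} (hx : x ∈ evenPart 𝕜 Γ) :
    grassmannLog1p 𝕜 x ∈ evenPart 𝕜 Γ := by
  rw [grassmannLog1p]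
  refine Subalgebra.sum_mem _ fun k _ => ?_
  rw [← algebraMap_smul 𝕜]
  exact Subalgebra.smul_mem _ (Subalgebra.pow_mem _ hx k) _

omit [DecidableEq Γ] in
/-- **The effective action of an even interaction is even**: `V ∈ ⋀^{even} ⇒ effAction C V ∈ ⋀^{even}` — the effective
potentials are sums of EVEN monomials at every scale (Benfatto–Giuliani–Mastropietro 2006, (2.15); the Gaussian
convolution, the exponential and the logarithm preserve parity). [cite: BenfattoGiulianiMastropietro2006, (2.15)] -/
theorem effAction_mem_evenPart (C : Matrix Γ Γ 𝕜) {V : GrassmannAlgebra 𝕜 Γ} (hV : V ∈ evenPart 𝕜 Γ)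
    (hV0 : constPart 𝕜 V = 0) : effAction 𝕜 C V ∈ evenPart 𝕜 Γ := by
  have hnV : IsNilpotent (-V) := isNilpotent_of_constPart_eq_zero 𝕜 (by rw [map_neg, hV0, neg_zero])
  have hexp : grassmannExp (-V) ∈ evenPart 𝕜 Γ :=
    (mem_evenPart_iff).2 (grassmannExp_mem_evenOdd_zero 𝕜 ((mem_evenPart_iff).1 (Subalgebra.neg_mem _ hV)) hnV)
  have hB : effBoltzmann 𝕜 C V ∈ evenPart 𝕜 Γ := by
    rw [effBoltzmann_def]
    exact (mem_evenPart_iff).2 (gaussConv_mem_evenOdd 𝕜 C ((mem_evenPart_iff).1 hexp))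
  rw [effAction_def]
  refine Subalgebra.neg_mem _ (grassmannLog1p_mem_evenPart ?_)
  exact Subalgebra.sub_mem _ (Subalgebra.smul_mem _ hB _) (Subalgebra.one_mem _)

/-! ### The flow of majorants -/

/-- **Iterating the single-scale step (the flow of majorants).**  Slices `C 0, C 1, …` on the label set `Γ`, all charged
for the same charge map `q` (`C j X Y = 0` for equal charges) and in Gram form on the mixed pairs with constants `κ j`
(vectors `f j, g j`), row and column sums of `‖C j‖` at most `α j`, entries at most `s j`, `Δ_{C j}^{k j} = 0`, output
field weights `ρ j`; an even interaction `V` without constant part; and majorants `N : ℕ → ℕ → ℝ`, `N j m ≥ 0`, with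
`N 0` dominating the pinned kernel norms of `V` and, for every slice `j < K`, `θ_j = e α_j ‖V‖_{h_j}[N j]/κ_j² < 1` and
`N (j+1) m ≥ N j m + Σ_{1 ≤ i < k j} ((m+2i)!/(m! i! 2^i)) (s j)^i N j (m+2i) + ρ_j^{-m} e‖V‖_{h_j}[N j] θ_j/(1-θ_j)` in every
degree `m ≥ 1` (the one-step flow inequality of `sum_norm_kernel_effAction_le_flow` evaluated AT THE MAJORANT).  Then for
every `n ≤ K`: every single-slice partition function `∫dμ_{C j} e^{-𝒱^{(j)}}`, `j < n`, is a unit; `𝒱^{(n)} =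
iterEffAction C n V` is even and has no constant part; and `Σ_{Y : Y_p = w} ‖kernel 𝒱^{(n)} m Y‖ ≤ N n m` for all `m, p, w`
(Benfatto–Giuliani–Mastropietro 2006, (2.12)–(2.14), (2.77)–(2.80), (2.86)–(2.90), with no localisation: the regime in
which the relevant couplings stay small by themselves). [cite: BenfattoGiulianiMastropietro2006, (2.77)-(2.80) and (2.86)-(2.90)] -/
theorem iterEffAction_flow {E : Type*} [NormedAddCommGroup E] [InnerProductSpace 𝕜 E]
    (q : Γ → Bool) (C : ℕ → Matrix Γ Γ 𝕜) (hC : ∀ j X Y, q X = q Y → C j X Y = 0)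
    (f g : ℕ → Γ → E) (κ : ℕ → ℝ) (hκ : ∀ j, 0 < κ j)
    (hf : ∀ j X, q X = true → ‖f j X‖ ≤ κ j) (hg : ∀ j Y, q Y = false → ‖g j Y‖ ≤ κ j)
    (hG : ∀ j X Y, q X = true → q Y = false → contr 𝕜 (C j) X Y = ⟪f j X, g j Y⟫_𝕜)
    (α : ℕ → ℝ) (hα : ∀ j, 0 < α j) (hrow : ∀ j X, ∑ Y, ‖C j X Y‖ ≤ α j) (hcol : ∀ j Y, ∑ X, ‖C j X Y‖ ≤ α j)
    (ρ : ℕ → ℝ) (hρ : ∀ j, 0 < ρ j) (s : ℕ → ℝ) (hs : ∀ j A B, ‖C j A B‖ ≤ s j)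
    (k : ℕ → ℕ) (hk : ∀ j, grassmannLaplacian 𝕜 (C j) ^ k j = 0)
    (V : GrassmannAlgebra 𝕜 Γ) (hV : V ∈ evenPart 𝕜 Γ) (hV0 : constPart 𝕜 V = 0)
    (N : ℕ → ℕ → ℝ) (hN0 : ∀ j m, 0 ≤ N j m)
    (hNV : ∀ (m : ℕ) (p : Fin m) (w : Γ), ∑ Y ∈ univ.filter (fun Y : Fin m → Γ => Y p = w), ‖kernel 𝕜 V m Y‖ ≤ N 0 m)
    (K : ℕ)
    (hθ : ∀ j < K, Real.exp 1 * α j * normV Γ (κ j) (ρ j) (fun m' => N j (2 * m')) / κ j ^ 2 < 1)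
    (hstep : ∀ j < K, ∀ m, 0 < m →
      N j m + ∑ i ∈ Ico 1 (k j), ((m + 2 * i)! : ℝ) / ((m ! : ℝ) * (i ! : ℝ) * 2 ^ i) * s j ^ i * N j (m + 2 * i) +
        (ρ j)⁻¹ ^ m * (Real.exp 1 * normV Γ (κ j) (ρ j) (fun m' => N j (2 * m'))) *
          (Real.exp 1 * α j * normV Γ (κ j) (ρ j) (fun m' => N j (2 * m')) / κ j ^ 2) /
            (1 - Real.exp 1 * α j * normV Γ (κ j) (ρ j) (fun m' => N j (2 * m')) / κ j ^ 2) ≤ N (j + 1) m) :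
    ∀ n ≤ K, (∀ j < n, IsUnit (effPartitionFn 𝕜 (C j) (iterEffAction 𝕜 C j V))) ∧
      iterEffAction 𝕜 C n V ∈ evenPart 𝕜 Γ ∧ constPart 𝕜 (iterEffAction 𝕜 C n V) = 0 ∧
      ∀ (m : ℕ) (p : Fin m) (w : Γ),
        ∑ Y ∈ univ.filter (fun Y : Fin m → Γ => Y p = w), ‖kernel 𝕜 (iterEffAction 𝕜 C n V) m Y‖ ≤ N n m := by
  intro n
  induction n with
  | zero =>
    intro _
    refine ⟨fun j hj => absurd hj (Nat.not_lt_zero j), ?_, ?_, ?_⟩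
    · rw [iterEffAction_zero]; exact hV
    · rw [iterEffAction_zero]; exact hV0
    · intro m p w; rw [iterEffAction_zero]; exact hNV m p w
  | succ n ih =>
    intro hn
    have hnK : n < K := Nat.lt_of_succ_le hn
    obtain ⟨hunits, heven, hconst, hker⟩ := ih hnK.le
    set Vn := iterEffAction 𝕜 C n V with hVn
    -- the single-scale step at slice `n`, applied to `𝒱^{(n)}` with the majorant `N n`
    have hNn : ∀ (m' : ℕ) (j : Fin (2 * m')) (w : Γ),
        ∑ Y ∈ univ.filter (fun Y : Fin (2 * m') → Γ => Y j = w), ‖kernel 𝕜 Vn (2 * m') Y‖ ≤ N n (2 * m') :=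
      fun m' j w => hker (2 * m') j w
    obtain ⟨hunit, -⟩ := sum_norm_kernel_effAction_le (C n) q (hC n) (f n) (g n) (hκ n) (hf n) (hg n) (hG n) Vn
      heven hconst (fun m' => N n (2 * m')) (fun m' => hN0 n _) hNn (hα n) (hrow n) (hcol n) (hρ n) (hθ n hnK)
    refine ⟨fun j hj => ?_, ?_, ?_, ?_⟩
    · rcases Nat.lt_succ_iff_lt_or_eq.1 hj with hj' | rfl
      · exact hunits j hj'
      · exact hunit
    · rw [iterEffAction_succ]; exact effAction_mem_evenPart (C n) heven hconst
    · rw [iterEffAction_succ]; exact constPart_effAction 𝕜 (C n) Vn hunit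
    · intro m p w
      rw [iterEffAction_succ]
      rcases Nat.eq_zero_or_pos m with rfl | hm
      · exact absurd p.2 (Nat.not_lt_zero _)
      · exact (sum_norm_kernel_effAction_le_flow (C n) q (hC n) (f n) (g n) (hκ n) (hf n) (hg n) (hG n) Vn heven hconst
          (N n) (hN0 n) hker (hα n) (hrow n) (hcol n) (hρ n) (hθ n hnK) (hs n) (hk n) hm p w).trans (hstep n hnK m hm)

/-- **The total effective action along the flow of majorants.**  Under the hypotheses of `iterEffAction_flow`:
integrating the total covariance `Σ_{j<K} C j` at once gives the iterated effective action `𝒱^{(K)}`, the total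
partition function `∫dμ_{Σ C j} e^{-V}` is the product of the single-slice partition functions and a unit, and the pinned
kernel norms of `effAction (Σ_{j<K} C j) V` are bounded by the last majorant `N K` in every degree
(Benfatto–Giuliani–Mastropietro 2006, (2.12)–(2.14): `log Z = Σ_j log Z_j`). [cite: BenfattoGiulianiMastropietro2006, (2.13)-(2.14)] -/
theorem effAction_sum_flow {E : Type*} [NormedAddCommGroup E] [InnerProductSpace 𝕜 E]
    (q : Γ → Bool) (C : ℕ → Matrix Γ Γ 𝕜) (hC : ∀ j X Y, q X = q Y → C j X Y = 0)
    (f g : ℕ → Γ → E) (κ : ℕ → ℝ) (hκ : ∀ j, 0 < κ j)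
    (hf : ∀ j X, q X = true → ‖f j X‖ ≤ κ j) (hg : ∀ j Y, q Y = false → ‖g j Y‖ ≤ κ j)
    (hG : ∀ j X Y, q X = true → q Y = false → contr 𝕜 (C j) X Y = ⟪f j X, g j Y⟫_𝕜)
    (α : ℕ → ℝ) (hα : ∀ j, 0 < α j) (hrow : ∀ j X, ∑ Y, ‖C j X Y‖ ≤ α j) (hcol : ∀ j Y, ∑ X, ‖C j X Y‖ ≤ α j)
    (ρ : ℕ → ℝ) (hρ : ∀ j, 0 < ρ j) (s : ℕ → ℝ) (hs : ∀ j A B, ‖C j A B‖ ≤ s j)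
    (k : ℕ → ℕ) (hk : ∀ j, grassmannLaplacian 𝕜 (C j) ^ k j = 0)
    (V : GrassmannAlgebra 𝕜 Γ) (hV : V ∈ evenPart 𝕜 Γ) (hV0 : constPart 𝕜 V = 0)
    (N : ℕ → ℕ → ℝ) (hN0 : ∀ j m, 0 ≤ N j m)
    (hNV : ∀ (m : ℕ) (p : Fin m) (w : Γ), ∑ Y ∈ univ.filter (fun Y : Fin m → Γ => Y p = w), ‖kernel 𝕜 V m Y‖ ≤ N 0 m)
    (K : ℕ)
    (hθ : ∀ j < K, Real.exp 1 * α j * normV Γ (κ j) (ρ j) (fun m' => N j (2 * m')) / κ j ^ 2 < 1)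
    (hstep : ∀ j < K, ∀ m, 0 < m →
      N j m + ∑ i ∈ Ico 1 (k j), ((m + 2 * i)! : ℝ) / ((m ! : ℝ) * (i ! : ℝ) * 2 ^ i) * s j ^ i * N j (m + 2 * i) +
        (ρ j)⁻¹ ^ m * (Real.exp 1 * normV Γ (κ j) (ρ j) (fun m' => N j (2 * m'))) *
          (Real.exp 1 * α j * normV Γ (κ j) (ρ j) (fun m' => N j (2 * m')) / κ j ^ 2) /
            (1 - Real.exp 1 * α j * normV Γ (κ j) (ρ j) (fun m' => N j (2 * m')) / κ j ^ 2) ≤ N (j + 1) m) :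
    effAction 𝕜 (∑ j ∈ range K, C j) V = iterEffAction 𝕜 C K V ∧
      effPartitionFn 𝕜 (∑ j ∈ range K, C j) V = ∏ j ∈ range K, effPartitionFn 𝕜 (C j) (iterEffAction 𝕜 C j V) ∧
      IsUnit (effPartitionFn 𝕜 (∑ j ∈ range K, C j) V) ∧
      ∀ (m : ℕ) (p : Fin m) (w : Γ),
        ∑ Y ∈ univ.filter (fun Y : Fin m → Γ => Y p = w), ‖kernel 𝕜 (effAction 𝕜 (∑ j ∈ range K, C j) V) m Y‖ ≤ N K m := by
  obtain ⟨hunits, -, -, hker⟩ := iterEffAction_flow q C hC f g κ hκ hf hg hG α hα hrow hcol ρ hρ s hs k hk V hV hV0 N hN0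
    hNV K hθ hstep K le_rfl
  obtain ⟨hA, hZ, hunit⟩ := effAction_sum_range_eq_iterEffAction (R := 𝕜) C hV0 K hunits
  refine ⟨hA, hZ, hunit, fun m p w => ?_⟩
  rw [hA]
  exact hker m p w

end Literature.MathematicalPhysics.QuantumLattice

end
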